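import Literature.Probability.Percolation.MooreShannonInfluenceBoundGeneral
import Literature.Probability.Percolation.KozmaNitzanSeparatingTriple
import Summits.CriticalPhenomena.PercolationContinuityZ3.Theorems.PercNearOneGluingNoHeavyLowerTailThreePointIsoSexticSureComponent
import HarnessLib

/-!
# Super-terminal coordinates along a cube pair: no gains for `Q`, `A`, `C` (the decrements `X̂, Â, Ĉ` are nonnegative)

Support file for crux `stmt-CriticalPhenomena-4575` (`NoHeavyLowerTail`), seat `prim-l12-p1` gen 26 (`--supports stmt-CriticalPhenomena-4575`);
memo `run/shared/lean/prim/prim-l12/FROM-prim-l12-p1-g26-THEOREM-R-KERNEL.md` §7; setting of `…SuperTerminalPortPairs` (`μ_w = prodBernoulli w`, root `s`,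
block partner `a`, singleton `b`, port `c`; `F = (s↔a) ∩ (s↔b)ᶜ`; `Q = μ(F ∩ c∤{s,a,b})`, `A = μ(F ∩ c∤{s,a})`, `C = μ(c∤{s,a,b})`; `K_c` = sure component).
No definitions, no sorries, standard axioms.

The lead's sign criterion for `(MAXDIR)` (prim-nh-lead-4575 g126, kernel algebra `…IncStarMaxdirSignCriterion`) starts from the probabilistic fact that the
events `E_Q = F ∩ c∤T`, `E_A = F ∩ c∤{s,a}` and `c∤T` cannot be CREATED by opening a pair `e = xv` with `x ∈ K_c`: a new `s–a` connection through `e`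
would join `c` (a.s. `∼ x`) to the block.  Hence the endpoint values are ordered, `Q(w[e↦1]) ≤ Q(w[e↦0])`, `A(w[e↦1]) ≤ A(w[e↦0])`, `C(w[e↦1]) ≤ C(w[e↦0])`
(`realQ_update_one_le`, `realA_update_one_le`, `realC_update_one_le`), i.e. the decrements `X̂_e, Â_e, Ĉ_e` of THEOREM R / R♯
(`…SuperTerminalQuarticOfMaxdir`, `…OfCritical`) are `≥ 0`.  (For `B = μ(F ∩ (c↔b)ᶜ)` there ARE gains — `B̂_e` may be negative — which is the whole difficulty.)
-/

namespace Summit.CriticalPhenomena.PercolationContinuityZ3.Theorems.SuperTerminalPortMonotone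

open MeasureTheory Set Filter
open Literature.Probability.Percolation Literature.Probability.LatticeModels
open Summit.CriticalPhenomena.PercolationContinuityZ3.Theorems.ThreePointIsoSexticSureComponent
open scoped Classical

variable {V : Type*} [Fintype V]

/-- Generic form: if almost surely `insert e ω ∈ E → ω ∖ {e} ∈ E`, then `μ_{w[e↦1]}(E) ≤ μ_{w[e↦0]}(E)`. [folklore] -/
theorem real_update_one_le_of_ae (w : Sym2 V → unitInterval) (e : Sym2 V) (E : Set (BondConfig V))
    (h : ∀ᵐ ω ∂(prodBernoulli w), insert e ω ∈ E → ω \ {e} ∈ E) :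
    (prodBernoulli (Function.update w e 1)).real E ≤ (prodBernoulli (Function.update w e 0)).real E := by
  rw [prodBernoulli_real_update_one_eq (determinedBy_coe_univ E) w (Finset.mem_univ e),
    prodBernoulli_real_update_zero_eq (determinedBy_coe_univ E) w (Finset.mem_univ e)]
  have hae : {ω : BondConfig V | insert e ω ∈ E} ≤ᵐ[prodBernoulli w] {ω : BondConfig V | ω \ {e} ∈ E} := by
    filter_upwards [h] with ω hω using hω
  simp only [measureReal_def]
  exact ENNReal.toReal_mono (measure_ne_top _ _) (measure_mono_ae hae)

/-- **No gain for `C = μ(c∤{s,a,b})`** along any pair: `C(w[e↦1]) ≤ C(w[e↦0])` (the event is decreasing). [this work] -/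
theorem realC_update_one_le (w : Sym2 V → unitInterval) (s a b c : V) (e : Sym2 V) :
    (prodBernoulli (Function.update w e 1)).real ((openConn c s)ᶜ ∩ (openConn c a)ᶜ ∩ (openConn c b)ᶜ : Set (BondConfig V)) ≤
      (prodBernoulli (Function.update w e 0)).real ((openConn c s)ᶜ ∩ (openConn c a)ᶜ ∩ (openConn c b)ᶜ : Set (BondConfig V)) := by
  refine real_update_one_le_of_ae w e _ (Eventually.of_forall fun ω hω => ?_)
  have hsub : ω \ {e} ⊆ insert e ω := sdiff_subset.trans (subset_insert _ _)
  simp only [mem_inter_iff, mem_compl_iff, openConn, mem_setOf_eq] at hω ⊢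
  exact ⟨⟨fun h' => hω.1.1 (h'.mono (openGraph_mono hsub)), fun h' => hω.1.2 (h'.mono (openGraph_mono hsub))⟩,
    fun h' => hω.2 (h'.mono (openGraph_mono hsub))⟩

/-- **No gain for `Q = μ(F ∩ c∤{s,a,b})`** along a pair `e = xv` with `x ∈ K_c`: `Q(w[e↦1]) ≤ Q(w[e↦0])`.  (If `insert e ω ∈ E_Q` then `c ∤ T` persists in
`ω ∖ e`; the `s–a` path of `insert e ω` cannot use `e`, since `x ∼ c` a.s. and `c` is separated from the block; `s ≁ b` persists.) [this work] -/
theorem realQ_update_one_le (w : Sym2 V → unitInterval) {s a b c x v : V} (hx : (openGraph {f : Sym2 V | (w f : ℝ) = 1}).Reachable c x)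
    (he : (w s(x, v) : ℝ) < 1) :
    (prodBernoulli (Function.update w s(x, v) 1)).real (openConn s a ∩ (openConn s b)ᶜ ∩ ((openConn c s)ᶜ ∩ (openConn c a)ᶜ ∩ (openConn c b)ᶜ) : Set (BondConfig V)) ≤
      (prodBernoulli (Function.update w s(x, v) 0)).real (openConn s a ∩ (openConn s b)ᶜ ∩ ((openConn c s)ᶜ ∩ (openConn c a)ᶜ ∩ (openConn c b)ᶜ) : Set (BondConfig V)) := by
  refine real_update_one_le_of_ae w s(x, v) _ ?_
  filter_upwards [ae_mem_of_weight_eq_one w] with ω hω hmem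
  have hins : insert s(x, v) ω = insert s(x, v) (ω \ {s(x, v)}) := by rw [insert_sdiff_singleton]
  rw [hins] at hmem
  have hsubw : {f : Sym2 V | (w f : ℝ) = 1} ⊆ ω \ {s(x, v)} := by
    intro f hf
    simp only [mem_setOf_eq] at hf
    exact ⟨hω f hf, fun h0 => absurd hf (by rw [mem_singleton_iff.1 h0]; exact he.ne)⟩
  have hcx : (openGraph (ω \ {s(x, v)})).Reachable c x := hx.mono (openGraph_mono hsubw)
  have hmono : ∀ {p q : V}, (openGraph (ω \ {s(x, v)})).Reachable p q → (openGraph (insert s(x, v) (ω \ {s(x, v)}))).Reachable p q :=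
    fun h => h.mono (openGraph_mono (subset_insert _ _))
  simp only [mem_inter_iff, mem_compl_iff, openConn, mem_setOf_eq] at hmem ⊢
  obtain ⟨⟨hsa, hsb⟩, ⟨hcs, hca⟩, hcb⟩ := hmem
  refine ⟨⟨?_, fun h => hsb (hmono h)⟩, ⟨fun h => hcs (hmono h), fun h => hca (hmono h)⟩, fun h => hcb (hmono h)⟩
  rw [KNSep.reachable_insert_iff] at hsa
  rcases hsa with h | ⟨hsx, _⟩ | ⟨_, hxa⟩
  · exact h
  · exact absurd (hmono (hcx.trans hsx.symm)) hcs
  · exact absurd (hmono (hcx.trans hxa)) hca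

/-- **No gain for `A = μ(F ∩ c∤{s,a})`** along a pair `e = xv` with `x ∈ K_c`: `A(w[e↦1]) ≤ A(w[e↦0])`. [this work] -/
theorem realA_update_one_le (w : Sym2 V → unitInterval) {s a b c x v : V} (hx : (openGraph {f : Sym2 V | (w f : ℝ) = 1}).Reachable c x)
    (he : (w s(x, v) : ℝ) < 1) :
    (prodBernoulli (Function.update w s(x, v) 1)).real (openConn s a ∩ (openConn s b)ᶜ ∩ ((openConn c s)ᶜ ∩ (openConn c a)ᶜ) : Set (BondConfig V)) ≤
      (prodBernoulli (Function.update w s(x, v) 0)).real (openConn s a ∩ (openConn s b)ᶜ ∩ ((openConn c s)ᶜ ∩ (openConn c a)ᶜ) : Set (BondConfig V)) := by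
  refine real_update_one_le_of_ae w s(x, v) _ ?_
  filter_upwards [ae_mem_of_weight_eq_one w] with ω hω hmem
  have hins : insert s(x, v) ω = insert s(x, v) (ω \ {s(x, v)}) := by rw [insert_sdiff_singleton]
  rw [hins] at hmem
  have hsubw : {f : Sym2 V | (w f : ℝ) = 1} ⊆ ω \ {s(x, v)} := by
    intro f hf
    simp only [mem_setOf_eq] at hf
    exact ⟨hω f hf, fun h0 => absurd hf (by rw [mem_singleton_iff.1 h0]; exact he.ne)⟩
  have hcx : (openGraph (ω \ {s(x, v)})).Reachable c x := hx.mono (openGraph_mono hsubw)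
  have hmono : ∀ {p q : V}, (openGraph (ω \ {s(x, v)})).Reachable p q → (openGraph (insert s(x, v) (ω \ {s(x, v)}))).Reachable p q :=
    fun h => h.mono (openGraph_mono (subset_insert _ _))
  simp only [mem_inter_iff, mem_compl_iff, openConn, mem_setOf_eq] at hmem ⊢
  obtain ⟨⟨hsa, hsb⟩, hcs, hca⟩ := hmem
  refine ⟨⟨?_, fun h => hsb (hmono h)⟩, fun h => hcs (hmono h), fun h => hca (hmono h)⟩
  rw [KNSep.reachable_insert_iff] at hsa
  rcases hsa with h | ⟨hsx, _⟩ | ⟨_, hxa⟩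
  · exact h
  · exact absurd (hmono (hcx.trans hsx.symm)) hcs
  · exact absurd (hmono (hcx.trans hxa)) hca

end Summit.CriticalPhenomena.PercolationContinuityZ3.Theorems.SuperTerminalPortMonotone
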